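import Mathlib
import HarnessLib
import Literature.MathematicalPhysics.QuantumLattice.GrassmannLinearSubstitution
import Literature.MathematicalPhysics.QuantumLattice.GrassmannChargeScaling
import Literature.MathematicalPhysics.QuantumLattice.GrassmannGramBoundedWeights
import Literature.MathematicalPhysics.QuantumLattice.GrassmannEffectiveActionLipschitzDB

/-!
# Route `KLProgramme` — crux K3, VL child `KLRegimeVolumeLimitV17F2` (stmt-HubbardSuperconductivity-20440): SPECTATOR LEGS —
# the observable sector rides on the ψ-flow (doubling `V(ψ) ↦ V(ψ + φ)`, block covariance, dead-variable rescaling, and the φ-GRADED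
# single-scale step as a corollary of the tree's Lipschitz step)
# (cell gate-hubbard-kl, seat hubbard-kl-k3c5-p3 g10, technique «OS-positivity-free direct assembly»; located risk VL-OBSERVABLE-SECTOR-g10 §3 (α)/(α′))

The VL stub compares the plain two-leg kernel of the fully integrated action `T_V(K)` at EVERY Matsubara label; a ψ-sectorised induction only
reaches the last shells (`…LastScaleSectorsVanish`).  The remedy of the memo's (α)/(α′) is to carry two PLAIN SPECTATOR legs `φ` through the
flow.  Generically (labels `Γ × Fin 2`: copy `0` = the integrated field `ψ`, copy `1` = the spectator `φ`), everything is a reading of tree lemmas: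

* §1 the spectator covariance `C′((X,s),(Y,s′)) = [s = s′ = 0]·C(X,Y)` (hypothesis `hC′`, no definition): block sum `= C`, rows/columns, antisymmetry,
  replica-Gram constant (`isGramBoundedR_spectator` ← [tree] `isGramBoundedR_mask` ∘ `IsGramBoundedR.submatrix`);
* §2 the doubling `Φ = ExteriorAlgebra.map (LinearMap.funLeft R R Prod.fst)` (`Φ V = V(ψ + φ)`, kernels = copies by [tree] `kernel_map_funLeft_fst`):
  **`effAction_spectator`** `effAction C′ (Φ V) = Φ (effAction C V)` and `effPartitionFn_spectator` ([tree] `effAction_fieldSum`), i.e. the doubled action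
  flows by the SAME semigroup and at the end its `φφ`-kernel IS the two-leg kernel of `T`; spectator rescaling `S_c` (`c = 1` on copy `0`) commutes with
  `effAction C′` EXACTLY (**`effAction_spectator_rescale`**, [tree] `effAction_map_mulLeft_of_covariance`); the copy-`0` part `ι₀ A = S_{𝟙₀}(Φ A)` flows inside
  copy `0` (`effAction_copyZero`) and has NO kernel with a spectator leg (`kernel_copyZero_eq_zero_of_leg`);
* §3 **`sum_norm_kernel_effAction_spectator_le`** — THE φ-GRADED SINGLE-SCALE STEP: for `V₁ = ι₀ A` (no spectator leg) and any even `B`, under the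
  smallness of [tree] `sum_norm_kernel_effAction_add_sub_le_of_gramBounded`, at every pin CARRYING A SPECTATOR LEG the whole pinned `L¹` kernel of
  `effAction C′ (ι₀ A + B)` is `≤ ρ^{-m}·e‖B‖_h/(1−θ)²` — LINEAR in the spectator sector `B` (the `ι₀ A`-term vanishes there), which is what a one-volume
  induction of the φ-sector profiles over the scales needs (memo (α′)); `…_of_exists_leg` is the same on the sub-sum of strings with a spectator leg at an
  arbitrary pin.

Proofs only; no definition; generic (`R` a commutative `ℚ`-algebra in §1–§2, `RCLike 𝕜` in §3).  References: BGM 2006 §2.9 (4.3)–(4.10a) (the external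
field carried through the flow), (2.12)–(2.14), (2.86)–(2.90); Salmhofer 1999 App. B.2; Gawȩdzki–Kupiainen 1985 §3.
-/

noncomputable section

namespace Summit.HubbardSuperconductivity.HubbardSuperconductivity.Theorems.TwoVolumeDefect

set_option linter.dupNamespace false -- summit = problem name (single-conjunct summit), D-0017

open Finset Literature.MathematicalPhysics.QuantumLattice GrassmannAlgebra Literature.Probability.LatticeModels
open scoped Nat

universe u

/-! ## §1 The spectator covariance -/

section Covariance

variable {R : Type*} [CommRing R] {Γ : Type*}
  (C : Matrix Γ Γ R) (C' : Matrix (Γ × Fin 2) (Γ × Fin 2) R)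
  (hC' : ∀ p q, C' p q = if p.2 = 0 ∧ q.2 = 0 then C p.1 q.1 else 0)
include hC'

/-- **The block sum of the spectator covariance is `C`**: `Σ_{s,s′} C′((X,s),(Y,s′)) = C(X,Y)`. [folklore] -/
theorem sum_sum_spectatorCov (X Y : Γ) : ∑ s : Fin 2, ∑ s' : Fin 2, C' (X, s) (Y, s') = C X Y := by
  simp [Fin.sum_univ_two, hC']

/-- The pulled-back covariance of the doubling is `C`. [folklore] -/
theorem of_sum_sum_spectatorCov : (Matrix.of fun X Y => ∑ s : Fin 2, ∑ s' : Fin 2, C' (X, s) (Y, s')) = C :=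
  Matrix.ext fun X Y => by rw [Matrix.of_apply, sum_sum_spectatorCov C C' hC']

/-- The spectator covariance vanishes on every spectator row. [folklore] -/
theorem spectatorCov_eq_zero_of_fst {p : Γ × Fin 2} (hp : p.2 = 1) (q : Γ × Fin 2) : C' p q = 0 := by
  rw [hC', if_neg (by simp [hp])]

/-- The spectator covariance vanishes on every spectator column. [folklore] -/
theorem spectatorCov_eq_zero_of_snd (p : Γ × Fin 2) {q : Γ × Fin 2} (hq : q.2 = 1) : C' p q = 0 := by
  rw [hC', if_neg (by simp [hq])]

/-- Antisymmetry is inherited. [folklore] -/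
theorem spectatorCov_transpose (hCt : ∀ X Y, C Y X = -C X Y) (p q : Γ × Fin 2) : C' q p = -C' p q := by
  rw [hC', hC']
  by_cases h : p.2 = 0 ∧ q.2 = 0
  · rw [if_pos ⟨h.2, h.1⟩, if_pos h, hCt]
  · rw [if_neg (fun h' => h ⟨h'.2, h'.1⟩), if_neg h, neg_zero]

end Covariance

section CovarianceNorm

variable {𝕜 : Type*} [RCLike 𝕜] {Γ : Type u} [Fintype Γ] [DecidableEq Γ]
  (C : Matrix Γ Γ 𝕜) (C' : Matrix (Γ × Fin 2) (Γ × Fin 2) 𝕜)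
  (hC' : ∀ p q, C' p q = if p.2 = 0 ∧ q.2 = 0 then C p.1 q.1 else 0)
include hC'

omit [DecidableEq Γ] in
/-- **Row sums**: `Σ_q ‖C′ p q‖ ≤ Σ_Y ‖C p.1 Y‖`. [folklore] -/
theorem sum_norm_spectatorCov_row_le (p : Γ × Fin 2) : ∑ q, ‖C' p q‖ ≤ ∑ Y, ‖C p.1 Y‖ := by
  rw [Fintype.sum_prod_type]
  refine sum_le_sum fun Y _ => ?_
  rw [Fin.sum_univ_two, hC', hC']
  by_cases hp : p.2 = 0
  · simp [hp]
  · simp [hp]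

omit [DecidableEq Γ] in
/-- **Column sums**: `Σ_p ‖C′ p q‖ ≤ Σ_X ‖C X q.1‖`. [folklore] -/
theorem sum_norm_spectatorCov_col_le (q : Γ × Fin 2) : ∑ p, ‖C' p q‖ ≤ ∑ X, ‖C X q.1‖ := by
  rw [Fintype.sum_prod_type]
  refine sum_le_sum fun X _ => ?_
  rw [Fin.sum_univ_two, hC', hC']
  by_cases hq : q.2 = 0
  · simp [hq]
  · simp [hq]

omit [Fintype Γ] [DecidableEq Γ] in
/-- **Sup entries**: `‖C′ p q‖ ≤ s` from `‖C X Y‖ ≤ s` (`0 ≤ s`). [folklore] -/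
theorem norm_spectatorCov_le {s : ℝ} (hs0 : 0 ≤ s) (hs : ∀ X Y, ‖C X Y‖ ≤ s) (p q : Γ × Fin 2) : ‖C' p q‖ ≤ s := by
  rw [hC']
  split_ifs
  · exact hs _ _
  · rwa [norm_zero]

/-- **The replica-Gram constant is inherited** (mask of the pull-back along `fst`). [cite: BenfattoGiulianiMastropietro2006, (2.80)] -/
theorem isGramBoundedR_spectator {κ : ℝ} (h : IsGramBoundedR C κ) : IsGramBoundedR C' κ := by
  classical
  refine isGramBoundedR_mask (h.submatrix (Prod.fst : Γ × Fin 2 → Γ)) {p : Γ × Fin 2 | p.2 = 0} C' fun p q => ?_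
  rw [hC']
  simp only [Set.mem_setOf_eq, Matrix.submatrix_apply]

end CovarianceNorm

/-! ## §2 The doubling, its flow, the copy-`0` inclusion and the spectator rescaling -/

section Doubling

variable {R : Type*} [CommRing R] [Algebra ℚ R] {Γ : Type*} [Fintype Γ] [DecidableEq Γ]
  (C : Matrix Γ Γ R) (C' : Matrix (Γ × Fin 2) (Γ × Fin 2) R)
  (hC' : ∀ p q, C' p q = if p.2 = 0 ∧ q.2 = 0 then C p.1 q.1 else 0)
include hC'

/-- **THE DOUBLED ACTION FLOWS BY THE SAME SEMIGROUP**: `effAction C′ (V(ψ+φ)) = (effAction C V)(ψ+φ)` — the spectator copy has covariance zero.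
[cite: BenfattoGiulianiMastropietro2006, (2.12)] -/
theorem effAction_spectator (V : GrassmannAlgebra R Γ) :
    effAction R C' (ExteriorAlgebra.map (LinearMap.funLeft R R (Prod.fst : Γ × Fin 2 → Γ)) V) =
      ExteriorAlgebra.map (LinearMap.funLeft R R (Prod.fst : Γ × Fin 2 → Γ)) (effAction R C V) := by
  rw [effAction_fieldSum, of_sum_sum_spectatorCov C C' hC']

/-- **The partition function does not see the spectator**: `∫dμ_{C′} e^{−V(ψ+φ)}|_{const} = ∫dμ_C e^{−V}`. [folklore] -/
theorem effPartitionFn_spectator (V : GrassmannAlgebra R Γ) :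
    effPartitionFn R C' (ExteriorAlgebra.map (LinearMap.funLeft R R (Prod.fst : Γ × Fin 2 → Γ)) V) = effPartitionFn R C V := by
  rw [effPartitionFn_map, transpose_mul_mul_funLeft_fst, of_sum_sum_spectatorCov C C' hC']

/-- **Spectator rescaling is exact**: for a weight `c` equal to `1` on copy `0`, `effAction C′ (S_c W) = S_c (effAction C′ W)` for EVERY `W` on the doubled labels
(dead variables). [folklore] -/
theorem effAction_spectator_rescale (c : Γ × Fin 2 → R) (hc : ∀ p : Γ × Fin 2, p.2 = 0 → c p = 1) (W : GrassmannAlgebra R (Γ × Fin 2)) :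
    effAction R C' (ExteriorAlgebra.map (LinearMap.mulLeft R c) W) = ExteriorAlgebra.map (LinearMap.mulLeft R c) (effAction R C' W) := by
  refine effAction_map_mulLeft_of_covariance R c (fun p q => ?_) W
  rw [hC']
  split_ifs with h
  · rw [hc p h.1, hc q h.2, one_mul, one_mul]
  · rw [mul_zero]

/-- **The copy-`0` inclusion flows inside copy `0`**: with `𝟙₀` the indicator of copy `0`, `ι₀ A := S_{𝟙₀}(A(ψ+φ)) = A(ψ)` and
`effAction C′ (ι₀ A) = ι₀ (effAction C A)`. [folklore] -/
theorem effAction_copyZero (c₀ : Γ × Fin 2 → R) (hc₀ : ∀ p : Γ × Fin 2, c₀ p = if p.2 = 0 then 1 else 0) (A : GrassmannAlgebra R Γ) :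
    effAction R C' (ExteriorAlgebra.map (LinearMap.mulLeft R c₀)
        (ExteriorAlgebra.map (LinearMap.funLeft R R (Prod.fst : Γ × Fin 2 → Γ)) A)) =
      ExteriorAlgebra.map (LinearMap.mulLeft R c₀) (ExteriorAlgebra.map (LinearMap.funLeft R R (Prod.fst : Γ × Fin 2 → Γ)) (effAction R C A)) := by
  rw [effAction_spectator_rescale C C' hC' c₀ (fun p hp => by rw [hc₀, if_pos hp]), effAction_spectator C C' hC']

omit [Fintype Γ] [DecidableEq Γ] hC' in
/-- **An element of copy `0` has no kernel with a spectator leg.** [folklore] -/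
theorem kernel_copyZero_eq_zero_of_leg (c₀ : Γ × Fin 2 → R) (hc₀ : ∀ p : Γ × Fin 2, c₀ p = if p.2 = 0 then 1 else 0)
    (Y : GrassmannAlgebra R (Γ × Fin 2)) {m : ℕ} (W : Fin m → Γ × Fin 2) (j : Fin m) (hj : (W j).2 = 1) :
    kernel R (ExteriorAlgebra.map (LinearMap.mulLeft R c₀) Y) m W = 0 := by
  rw [kernel_map_mulLeft, prod_eq_zero (mem_univ j) (by rw [hc₀, if_neg (by simp [hj])]), zero_mul]

omit hC' in
/-- **Kernels of the doubled action are copies**: `kernel (V(ψ+φ)) m W = kernel V m (fst ∘ W)` (restated from [tree] `kernel_map_funLeft_fst` at `S = Fin 2`;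
in particular the `φφ`-kernel of `T(ψ+φ)` is the two-leg kernel of `T`). [folklore] -/
theorem kernel_spectator_doubling (V : GrassmannAlgebra R Γ) (m : ℕ) (W : Fin m → Γ × Fin 2) :
    kernel R (ExteriorAlgebra.map (LinearMap.funLeft R R (Prod.fst : Γ × Fin 2 → Γ)) V) m W = kernel R V m (Prod.fst ∘ W) :=
  kernel_map_funLeft_fst R V m W

end Doubling

/-! ## §3 The φ-graded single-scale step: at a spectator pin the kernel is linear in the spectator sector -/

section Graded

variable {𝕜 : Type*} [RCLike 𝕜] {Γ : Type u} [Fintype Γ] [DecidableEq Γ]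
  (C : Matrix Γ Γ 𝕜) (C' : Matrix (Γ × Fin 2) (Γ × Fin 2) 𝕜)
  (hC' : ∀ p q, C' p q = if p.2 = 0 ∧ q.2 = 0 then C p.1 q.1 else 0)
include hC'

/-- **THE φ-GRADED SINGLE-SCALE STEP.**  Covariance `C` replica-Gram-bounded (`κ`) with row/column sums `≤ α`, spectator covariance `C′`; `V₁` an even
element of copy `0` (`V₁ = S_{𝟙₀} Y`, no constant part, pinned profile `N₁` on the doubled labels), `B` any even element without constant part (profile
`N₂`), `θ = eα(‖V₁‖_h + ‖B‖_h)/κ² < 1`.  Then the partition functions are units and, at EVERY PIN CARRYING A SPECTATOR LEG, in every degree `m ≥ 1`,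
`Σ_{W : W_i = w} ‖kernel_m (effAction C′ (V₁ + B)) (W)‖ ≤ ρ^{-m} · e‖B‖_h / (1 − θ)²` — linear in the spectator sector.
[cite: BenfattoGiulianiMastropietro2006, (2.13)-(2.14) and (2.86)-(2.90)] -/
theorem sum_norm_kernel_effAction_spectator_le {κ : ℝ} (hκ : 0 < κ) (hGB : IsGramBoundedR C κ)
    (c₀ : Γ × Fin 2 → 𝕜) (hc₀ : ∀ p : Γ × Fin 2, c₀ p = if p.2 = 0 then 1 else 0)
    (Y B : GrassmannAlgebra 𝕜 (Γ × Fin 2)) (hV₁ : ExteriorAlgebra.map (LinearMap.mulLeft 𝕜 c₀) Y ∈ evenPart 𝕜 (Γ × Fin 2))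
    (hB : B ∈ evenPart 𝕜 (Γ × Fin 2)) (hV₁0 : constPart 𝕜 (ExteriorAlgebra.map (LinearMap.mulLeft 𝕜 c₀) Y) = 0) (hB0 : constPart 𝕜 B = 0)
    (N₁ N₂ : ℕ → ℝ) (hN₁0 : ∀ m', 0 ≤ N₁ m') (hN₂0 : ∀ m', 0 ≤ N₂ m')
    (hN₁ : ∀ m' (j : Fin (2 * m')) (w : Γ × Fin 2), ∑ W ∈ univ.filter (fun W : Fin (2 * m') → Γ × Fin 2 => W j = w),
      ‖kernel 𝕜 (ExteriorAlgebra.map (LinearMap.mulLeft 𝕜 c₀) Y) (2 * m') W‖ ≤ N₁ m')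
    (hN₂ : ∀ m' (j : Fin (2 * m')) (w : Γ × Fin 2), ∑ W ∈ univ.filter (fun W : Fin (2 * m') → Γ × Fin 2 => W j = w),
      ‖kernel 𝕜 B (2 * m') W‖ ≤ N₂ m')
    {α : ℝ} (hα : 0 < α) (hrow : ∀ X, ∑ Y, ‖C X Y‖ ≤ α) (hcol : ∀ Y, ∑ X, ‖C X Y‖ ≤ α) {ρ : ℝ} (hρ : 0 < ρ)
    (hθ : Real.exp 1 * α * (normV (Γ × Fin 2) κ ρ N₁ + normV (Γ × Fin 2) κ ρ N₂) / κ ^ 2 < 1) :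
    IsUnit (effPartitionFn 𝕜 C' (ExteriorAlgebra.map (LinearMap.mulLeft 𝕜 c₀) Y)) ∧
      IsUnit (effPartitionFn 𝕜 C' (ExteriorAlgebra.map (LinearMap.mulLeft 𝕜 c₀) Y + B)) ∧
      ∀ {m : ℕ}, 0 < m → ∀ (i : Fin m) (w : Γ × Fin 2), w.2 = 1 →
        ∑ W ∈ univ.filter (fun W : Fin m → Γ × Fin 2 => W i = w),
          ‖kernel 𝕜 (effAction 𝕜 C' (ExteriorAlgebra.map (LinearMap.mulLeft 𝕜 c₀) Y + B)) m W‖ ≤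
        ρ⁻¹ ^ m * (Real.exp 1 * normV (Γ × Fin 2) κ ρ N₂) /
          (1 - Real.exp 1 * α * (normV (Γ × Fin 2) κ ρ N₁ + normV (Γ × Fin 2) κ ρ N₂) / κ ^ 2) ^ 2 := by
  have hrow' : ∀ p : Γ × Fin 2, ∑ q, ‖C' p q‖ ≤ α := fun p => (sum_norm_spectatorCov_row_le C C' hC' p).trans (hrow p.1)
  have hcol' : ∀ q : Γ × Fin 2, ∑ p, ‖C' p q‖ ≤ α := fun q => (sum_norm_spectatorCov_col_le C C' hC' q).trans (hcol q.1)
  obtain ⟨hZ₁, hZ₁₂, hLip⟩ := sum_norm_kernel_effAction_add_sub_le_of_gramBounded C' hκ (isGramBoundedR_spectator C C' hC' hGB)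
    _ B hV₁ hB hV₁0 hB0 N₁ N₂ hN₁0 hN₂0 hN₁ hN₂ hα hrow' hcol' hρ hθ
  refine ⟨hZ₁, hZ₁₂, fun {m} hm i w hw => ?_⟩
  -- the copy-`0` term has no kernel at a spectator pin: `effAction C′ V₁ = S_{𝟙₀} (effAction C′ Y)` (dead variables)
  have hflow : effAction 𝕜 C' (ExteriorAlgebra.map (LinearMap.mulLeft 𝕜 c₀) Y) =
      ExteriorAlgebra.map (LinearMap.mulLeft 𝕜 c₀) (effAction 𝕜 C' Y) :=
    effAction_spectator_rescale C C' hC' c₀ (fun p hp => by rw [hc₀, if_pos hp]) Y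
  have hzero : ∀ W ∈ univ.filter (fun W : Fin m → Γ × Fin 2 => W i = w),
      kernel 𝕜 (effAction 𝕜 C' (ExteriorAlgebra.map (LinearMap.mulLeft 𝕜 c₀) Y)) m W = 0 := by
    intro W hW
    rw [hflow]
    refine kernel_copyZero_eq_zero_of_leg c₀ hc₀ _ W i ?_
    rw [(mem_filter.1 hW).2, hw]
  calc ∑ W ∈ univ.filter (fun W : Fin m → Γ × Fin 2 => W i = w),
          ‖kernel 𝕜 (effAction 𝕜 C' (ExteriorAlgebra.map (LinearMap.mulLeft 𝕜 c₀) Y + B)) m W‖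
      = ∑ W ∈ univ.filter (fun W : Fin m → Γ × Fin 2 => W i = w),
          ‖kernel 𝕜 (effAction 𝕜 C' (ExteriorAlgebra.map (LinearMap.mulLeft 𝕜 c₀) Y + B)) m W -
            kernel 𝕜 (effAction 𝕜 C' (ExteriorAlgebra.map (LinearMap.mulLeft 𝕜 c₀) Y)) m W‖ :=
        sum_congr rfl fun W hW => by rw [hzero W hW, sub_zero]
    _ ≤ _ := hLip hm i w

/-- **The same on the sub-sum of strings with a spectator leg, at an arbitrary pin.** [cite: BenfattoGiulianiMastropietro2006, (2.86)-(2.90)] -/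
theorem sum_norm_kernel_effAction_spectator_le_of_exists_leg {κ : ℝ} (hκ : 0 < κ) (hGB : IsGramBoundedR C κ)
    (c₀ : Γ × Fin 2 → 𝕜) (hc₀ : ∀ p : Γ × Fin 2, c₀ p = if p.2 = 0 then 1 else 0)
    (Y B : GrassmannAlgebra 𝕜 (Γ × Fin 2)) (hV₁ : ExteriorAlgebra.map (LinearMap.mulLeft 𝕜 c₀) Y ∈ evenPart 𝕜 (Γ × Fin 2))
    (hB : B ∈ evenPart 𝕜 (Γ × Fin 2)) (hV₁0 : constPart 𝕜 (ExteriorAlgebra.map (LinearMap.mulLeft 𝕜 c₀) Y) = 0) (hB0 : constPart 𝕜 B = 0)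
    (N₁ N₂ : ℕ → ℝ) (hN₁0 : ∀ m', 0 ≤ N₁ m') (hN₂0 : ∀ m', 0 ≤ N₂ m')
    (hN₁ : ∀ m' (j : Fin (2 * m')) (w : Γ × Fin 2), ∑ W ∈ univ.filter (fun W : Fin (2 * m') → Γ × Fin 2 => W j = w),
      ‖kernel 𝕜 (ExteriorAlgebra.map (LinearMap.mulLeft 𝕜 c₀) Y) (2 * m') W‖ ≤ N₁ m')
    (hN₂ : ∀ m' (j : Fin (2 * m')) (w : Γ × Fin 2), ∑ W ∈ univ.filter (fun W : Fin (2 * m') → Γ × Fin 2 => W j = w),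
      ‖kernel 𝕜 B (2 * m') W‖ ≤ N₂ m')
    {α : ℝ} (hα : 0 < α) (hrow : ∀ X, ∑ Y, ‖C X Y‖ ≤ α) (hcol : ∀ Y, ∑ X, ‖C X Y‖ ≤ α) {ρ : ℝ} (hρ : 0 < ρ)
    (hθ : Real.exp 1 * α * (normV (Γ × Fin 2) κ ρ N₁ + normV (Γ × Fin 2) κ ρ N₂) / κ ^ 2 < 1)
    {m : ℕ} (hm : 0 < m) (i : Fin m) (w : Γ × Fin 2) :
    ∑ W ∈ univ.filter (fun W : Fin m → Γ × Fin 2 => W i = w ∧ ∃ j, (W j).2 = 1),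
        ‖kernel 𝕜 (effAction 𝕜 C' (ExteriorAlgebra.map (LinearMap.mulLeft 𝕜 c₀) Y + B)) m W‖ ≤
      ρ⁻¹ ^ m * (Real.exp 1 * normV (Γ × Fin 2) κ ρ N₂) /
        (1 - Real.exp 1 * α * (normV (Γ × Fin 2) κ ρ N₁ + normV (Γ × Fin 2) κ ρ N₂) / κ ^ 2) ^ 2 := by
  have hrow' : ∀ p : Γ × Fin 2, ∑ q, ‖C' p q‖ ≤ α := fun p => (sum_norm_spectatorCov_row_le C C' hC' p).trans (hrow p.1)
  have hcol' : ∀ q : Γ × Fin 2, ∑ p, ‖C' p q‖ ≤ α := fun q => (sum_norm_spectatorCov_col_le C C' hC' q).trans (hcol q.1)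
  obtain ⟨-, -, hLip⟩ := sum_norm_kernel_effAction_add_sub_le_of_gramBounded C' hκ (isGramBoundedR_spectator C C' hC' hGB)
    _ B hV₁ hB hV₁0 hB0 N₁ N₂ hN₁0 hN₂0 hN₁ hN₂ hα hrow' hcol' hρ hθ
  have hflow : effAction 𝕜 C' (ExteriorAlgebra.map (LinearMap.mulLeft 𝕜 c₀) Y) =
      ExteriorAlgebra.map (LinearMap.mulLeft 𝕜 c₀) (effAction 𝕜 C' Y) :=
    effAction_spectator_rescale C C' hC' c₀ (fun p hp => by rw [hc₀, if_pos hp]) Y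
  have hzero : ∀ W ∈ univ.filter (fun W : Fin m → Γ × Fin 2 => W i = w ∧ ∃ j, (W j).2 = 1),
      kernel 𝕜 (effAction 𝕜 C' (ExteriorAlgebra.map (LinearMap.mulLeft 𝕜 c₀) Y)) m W = 0 := by
    intro W hW
    obtain ⟨j, hj⟩ := (mem_filter.1 hW).2.2
    rw [hflow]
    exact kernel_copyZero_eq_zero_of_leg c₀ hc₀ _ W j hj
  calc ∑ W ∈ univ.filter (fun W : Fin m → Γ × Fin 2 => W i = w ∧ ∃ j, (W j).2 = 1),
          ‖kernel 𝕜 (effAction 𝕜 C' (ExteriorAlgebra.map (LinearMap.mulLeft 𝕜 c₀) Y + B)) m W‖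
      = ∑ W ∈ univ.filter (fun W : Fin m → Γ × Fin 2 => W i = w ∧ ∃ j, (W j).2 = 1),
          ‖kernel 𝕜 (effAction 𝕜 C' (ExteriorAlgebra.map (LinearMap.mulLeft 𝕜 c₀) Y + B)) m W -
            kernel 𝕜 (effAction 𝕜 C' (ExteriorAlgebra.map (LinearMap.mulLeft 𝕜 c₀) Y)) m W‖ :=
        sum_congr rfl fun W hW => by rw [hzero W hW, sub_zero]
    _ ≤ ∑ W ∈ univ.filter (fun W : Fin m → Γ × Fin 2 => W i = w),
          ‖kernel 𝕜 (effAction 𝕜 C' (ExteriorAlgebra.map (LinearMap.mulLeft 𝕜 c₀) Y + B)) m W -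
            kernel 𝕜 (effAction 𝕜 C' (ExteriorAlgebra.map (LinearMap.mulLeft 𝕜 c₀) Y)) m W‖ :=
        sum_le_sum_of_subset_of_nonneg (fun W hW => mem_filter.2 ⟨mem_univ _, (mem_filter.1 hW).2.1⟩) fun _ _ _ => norm_nonneg _
    _ ≤ _ := hLip hm i w

end Graded

/-! ## §4 Source shifts and dressings: every substitution whose copy-`0` rows are the identity commutes with `effAction C′`

(Append, same seat/gen.)  **`effAction_spectator_map_of_copyZero_rows`** — EVERY substitution with identity copy-`0` rows (source dressing `φ ↦ Gφ`,
source SHIFT `ψ ↦ ψ + Gφ`: BGM 2006 §2.9 (4.4)–(4.9), Dimock 2025 Prop. 7) commutes with `effAction C′` exactly (`Tᵀ C′ T = C′`, no smallness, no unit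
hypothesis); `effAction_spectator_dressed` = doubling ∘ dressing: `effAction C′ (V(ψ + Gφ)) = (effAction C V)(ψ + Gφ)` — k3c4-p1's (R-src) dressed
organisation `D^{(h)}` and this file's amputated `A_h` are the same object up to such a substitution. -/

section Shift

variable {R : Type*} [CommRing R] [Algebra ℚ R] {Γ : Type*} [Fintype Γ] [DecidableEq Γ]
  (C : Matrix Γ Γ R) (C' : Matrix (Γ × Fin 2) (Γ × Fin 2) R)
  (hC' : ∀ p q, C' p q = if p.2 = 0 ∧ q.2 = 0 then C p.1 q.1 else 0)
include hC'

omit [Algebra ℚ R] in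
/-- **The pulled-back covariance of a substitution with identity copy-`0` rows is `C′` again**: if `T (X,0) q = [q = (X,0)]` (the integrated
field is reproduced exactly; the copy-`1` rows — dressing `φ ↦ Gφ` of the source and SHIFT `ψ ↦ ψ + Gφ` of the field — are arbitrary), then
`Tᵀ C′ T = C′`. [cite: BenfattoGiulianiMastropietro2006, §2.9 (4.4)-(4.9)] -/
theorem transpose_mul_spectatorCov_mul_of_copyZero_rows (T : Matrix (Γ × Fin 2) (Γ × Fin 2) R)
    (hT : ∀ (X : Γ) (q : Γ × Fin 2), T (X, 0) q = if q = (X, 0) then 1 else 0) : T.transpose * C' * T = C' := by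
  ext p q
  rw [Matrix.mul_apply]
  simp_rw [Matrix.mul_apply, Matrix.transpose_apply]
  -- only copy-`0` labels `a = (X,0)`, `b = (Y,0)` contribute, with `T (X,0) p = [p = (X,0)]`
  have hvan : ∀ a b : Γ × Fin 2, ¬ (a.2 = 0 ∧ b.2 = 0) → T a p * C' a b * T b q = 0 := fun a b h => by
    rw [hC' a b, if_neg h, mul_zero, zero_mul]
  calc ∑ b, (∑ a, T a p * C' a b) * T b q
      = ∑ b, ∑ a, T a p * C' a b * T b q := by simp_rw [sum_mul]
    _ = ∑ Y : Γ, ∑ X : Γ, T (X, 0) p * C' (X, 0) (Y, 0) * T (Y, 0) q := by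
        rw [Fintype.sum_prod_type]
        simp_rw [Fin.sum_univ_two]
        rw [Finset.sum_add_distrib]
        have h1 : ∑ Y : Γ, ∑ a, T a p * C' a (Y, 1) * T (Y, 1) q = 0 :=
          sum_eq_zero fun Y _ => sum_eq_zero fun a _ => hvan a (Y, 1) (by simp)
        rw [h1, add_zero]
        refine sum_congr rfl fun Y _ => ?_
        rw [Fintype.sum_prod_type]
        simp_rw [Fin.sum_univ_two]
        rw [Finset.sum_add_distrib]
        have h2 : ∑ X : Γ, T (X, 1) p * C' (X, 1) (Y, 0) * T (Y, 0) q = 0 :=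
          sum_eq_zero fun X _ => hvan (X, 1) (Y, 0) (by simp)
        rw [h2, add_zero]
    _ = C' p q := by
        simp_rw [hT]
        by_cases hp : p.2 = 0
        · by_cases hq : q.2 = 0
          · have hp' : p = (p.1, 0) := Prod.ext rfl hp
            have hq' : q = (q.1, 0) := Prod.ext rfl hq
            rw [sum_eq_single q.1, sum_eq_single p.1]
            · rw [if_pos hp', if_pos hq', one_mul, mul_one, ← hp', ← hq']
            · intro X _ hX
              rw [if_neg (fun h => hX (by rw [h])), zero_mul, zero_mul]
            · exact fun h => (h (mem_univ _)).elim
            · intro Y _ hY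
              refine sum_eq_zero fun X _ => ?_
              rw [if_neg (show ¬ (q = (Y, 0)) from fun h => hY (by rw [h])), mul_zero]
            · exact fun h => (h (mem_univ _)).elim
          · rw [hC' p q, if_neg (fun h => hq h.2)]
            refine sum_eq_zero fun Y _ => sum_eq_zero fun X _ => ?_
            rw [if_neg (show ¬ (q = (Y, 0)) from fun h => hq (by rw [h])), mul_zero]
        · rw [hC' p q, if_neg (fun h => hp h.1)]
          refine sum_eq_zero fun Y _ => sum_eq_zero fun X _ => ?_
          rw [if_neg (fun h => hp (by rw [h])), zero_mul, zero_mul]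

/-- **SOURCE SHIFTS AND DRESSINGS COMMUTE WITH THE STEP**: for every substitution `T` with identity copy-`0` rows (`ψ_X ↦ ψ_X + Σ_Y T((Y,1),(X,0)) φ_Y`,
`φ_X ↦ Σ_Y T((Y,1),(X,1)) φ_Y`) and EVERY `W` on the doubled labels, `effAction C′ (W ∘ T) = (effAction C′ W) ∘ T` — BGM's per-scale source bookkeeping
(4.4)–(4.9) / Dimock's Prop. 7 in the tree's `effAction` formalism, with no smallness and no unit hypothesis.
[cite: BenfattoGiulianiMastropietro2006, §2.9 (4.4)-(4.9)] -/
theorem effAction_spectator_map_of_copyZero_rows (T : Matrix (Γ × Fin 2) (Γ × Fin 2) R)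
    (hT : ∀ (X : Γ) (q : Γ × Fin 2), T (X, 0) q = if q = (X, 0) then 1 else 0) (W : GrassmannAlgebra R (Γ × Fin 2)) :
    effAction R C' (ExteriorAlgebra.map (Matrix.toLin' T) W) = ExteriorAlgebra.map (Matrix.toLin' T) (effAction R C' W) := by
  rw [effAction_map, LinearMap.toMatrix'_toLin', transpose_mul_spectatorCov_mul_of_copyZero_rows C C' hC' T hT]

/-- The partition function is invariant under every such substitution. [folklore] -/
theorem effPartitionFn_spectator_map_of_copyZero_rows (T : Matrix (Γ × Fin 2) (Γ × Fin 2) R)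
    (hT : ∀ (X : Γ) (q : Γ × Fin 2), T (X, 0) q = if q = (X, 0) then 1 else 0) (W : GrassmannAlgebra R (Γ × Fin 2)) :
    effPartitionFn R C' (ExteriorAlgebra.map (Matrix.toLin' T) W) = effPartitionFn R C' W := by
  rw [effPartitionFn_map, LinearMap.toMatrix'_toLin', transpose_mul_spectatorCov_mul_of_copyZero_rows C C' hC' T hT]

/-- **The dressed doubling**: `effAction C′ (V(ψ + Gφ)) = (effAction C V)(ψ + Gφ)` for EVERY dressing of the source legs — the composite of the
doubling (`effAction_spectator`) and a substitution with identity copy-`0` rows. [cite: BenfattoGiulianiMastropietro2006, §2.9 (4.6)] -/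
theorem effAction_spectator_dressed (T : Matrix (Γ × Fin 2) (Γ × Fin 2) R)
    (hT : ∀ (X : Γ) (q : Γ × Fin 2), T (X, 0) q = if q = (X, 0) then 1 else 0) (V : GrassmannAlgebra R Γ) :
    effAction R C' (ExteriorAlgebra.map (Matrix.toLin' T) (ExteriorAlgebra.map (LinearMap.funLeft R R (Prod.fst : Γ × Fin 2 → Γ)) V)) =
      ExteriorAlgebra.map (Matrix.toLin' T) (ExteriorAlgebra.map (LinearMap.funLeft R R (Prod.fst : Γ × Fin 2 → Γ)) (effAction R C V)) := by
  rw [effAction_spectator_map_of_copyZero_rows C C' hC' T hT, effAction_spectator C C' hC']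

end Shift

end Summit.HubbardSuperconductivity.HubbardSuperconductivity.Theorems.TwoVolumeDefect
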